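import Summits.HodgeConjecture.HodgeConjecture.Theorems.HolomorphicityRateRateGapOfHodge
import HarnessLib

/-!
# Route `HolomorphicityRate`, crux `RateGap` (R1): the unconditional window

Crux item `stmt-HodgeConjecture-10762` (`HolomorphicityRate.RateGap`). The lead's cancellation argument
(`rateGap_of_hodgeBelowMiddle`, file `HolomorphicityRateRateGapOfHodge`) shows that the crux's conclusion
for a class `c` needs nothing but `c ∈ algebraicClasses X p` (take `hp := -c`: the ray class
`1 • c + (min k 1) • (-c)` vanishes for `k ≥ 1`, and any holomorphic cycle support of codimension `p`
carries it). This file records the POINTWISE consequences, all unconditional, as helpers towards the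
crux (`--supports`):

* `rateGap_conclusion_of_mem_algebraicClasses` — the crux's conclusion for every `(X, A, c)` with `c`
  rational and algebraic, `0 < p ≤ n` (no Hodge-type hypothesis is used).
* `rateGap_conclusion_of_hodgeConjectureFor` — the crux's conclusion on every `X` for which the tree
  knows the Hodge conjecture (`HodgeConjectureFor n X`), e.g. `n ≤ 3`
  (`hodgeConjectureFor_of_dim_le_three_holds`): `rateGap_conclusion_of_dim_le_three`.
* `rateGap_conclusion_outside_window` — the crux's conclusion OUTRIGHT in the codimensions the tree
  settles on every smooth projective `n`-fold: `p ≤ 1` (codimension `0`: empty complement;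
  codimension `1`: Lefschetz `(1,1)`, `lefschetzOneOne_rational_holds`) and `n ≤ p + 1` (top degree
  `mem_algebraicClasses_of_degree_top`; `p = n - 1`: hard Lefschetz
  `HardLefschetzNFold.mem_algebraicClasses_of_lt_holds` down to codimension `1`).

So the crux is open exactly in the window `2 ≤ p ≤ n - 2` (equivalently, by hard Lefschetz, `2 ≤ p ≤ n/2`,
`mem_algebraicClasses_of_hodgeBelowMiddle`), where its registered stub `stub_hodgeBelowMiddle` is the
Hodge conjecture itself.

## References

* P. Deligne, *The Hodge conjecture*, Clay problem description (2000), §1.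
* C. Voisin, *Hodge Theory and Complex Algebraic Geometry I* (2002), Thm. 6.25, Thm. 11.30.
* M. Kerr, G. Pearlstein, *An exponential history of functions with logarithmic growth* (2011), §3.1.
-/

noncomputable section

open scoped Manifold ContDiff Topology
open Set Filter

-- `Summit.HodgeConjecture.HodgeConjecture.Theorems` is the mandated namespace (single-conjunct summit:
-- Sub = Summit), which `linter.dupNamespace` flags on every declaration; the lakefile turns the
-- linter off tree-wide (weak option), restated here so stand-alone elaboration is warning-free too.
set_option linter.dupNamespace false

namespace Summit.HodgeConjecture.HodgeConjecture.Theorems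

open Literature.AlgebraicGeometry.HodgeTheory Literature.AlgebraicGeometry.Motives
  Literature.AlgebraicTopology.SingularHomology Literature.Geometry.Kaehler

/-- **The crux's conclusion for an algebraic class (cancellation on the ray), pointwise.** For `X`
smooth projective of dimension `n`, `0 < p ≤ n`, a Hodge model `A` and a class `c` which is rational
and ALGEBRAIC (`c ∈ algebraicClasses X p = Nᵖ H²ᵖ`), the conclusion of `HolomorphicityRate.RateGap`
holds for `(A, c)`: any smooth metric `g` (`nonempty_contMDiffRiemannianMetric`), `m := 1`, `hp := -c`
(rational by `IsRationalClass.smul`, algebraic by `Submodule.neg_mem`), `C := 1`, `a k := min k 1`,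
`δ := 1`, `C' := 0`; for `k ≥ 1` the ray class `1 • c + (min k 1) • (-c)` is `0`, so its pull-back dies
off every set, and the support clause is met by a holomorphic cycle support of codimension `p`
(`stub_existsHolomorphicCycleSupport`, defect `0 = 0 · k^{-(p+1)}`, empty bad set), unfolded by
`isNearlyHolomorphicCycleSupport_toRiemannianMetric_iff`. No Hodge-type hypothesis is needed.
[cite: Deligne2000, §1] -/
theorem rateGap_conclusion_of_mem_algebraicClasses (n p : ℕ)
    (X : Literature.AlgebraicGeometry.Motives.SchemeOver ℂ)
    (hX : Literature.AlgebraicGeometry.Motives.IsSmoothProjective n X) (hpn : p ≤ n) (hp0 : 0 < p)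
    (A : Literature.AlgebraicGeometry.HodgeTheory.HodgeModel n X)
    (c : Literature.AlgebraicGeometry.HodgeTheory.complexBetti X (2 * p))
    (hc : Literature.AlgebraicGeometry.HodgeTheory.IsRationalClass c)
    (halg : c ∈ Literature.AlgebraicGeometry.HodgeTheory.algebraicClasses X p) :
    ∃ (g : Bundle.ContMDiffRiemannianMetric 𝓘(ℝ, A.model) ((⊤ : ℕ∞) : WithTop ℕ∞) A.model (fun x : A.carrier => TangentSpace 𝓘(ℝ, A.model) x)) (m : ℕ) (hp : Literature.AlgebraicGeometry.HodgeTheory.complexBetti X (2 * p)) (C : ℝ) (a : ℕ → ℕ) (δ C' : ℝ), 0 < m ∧ Literature.AlgebraicGeometry.HodgeTheory.IsRationalClass hp ∧ hp ∈ Literature.AlgebraicGeometry.HodgeTheory.algebraicClasses X p ∧ (∀ k, (a k : ℝ) ≤ C * (k : ℝ) ^ p) ∧ 0 < δ ∧ ∃ᶠ k : ℕ in Filter.atTop, ∃ S Sg : Set A.carrier, (IsClosed S ∧ IsClosed Sg ∧ Sg ⊆ S ∧ IsConnected (S \ Sg) ∧ (∀ x ∈ Sg, Literature.Geometry.Kaehler.IsAnalyticSetAt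 𝓘(ℂ, A.model) S x) ∧ (∃ T : Set A.carrier, Sg ⊆ T ∧ (Literature.Geometry.Kaehler.IsAnalyticSet 𝓘(ℂ, A.model) T ∧ ∀ x ∈ Literature.Geometry.Kaehler.regularLocus 𝓘(ℂ, A.model) T, ∀ q : ℕ, Literature.Geometry.Kaehler.IsRegularPointOfCodim 𝓘(ℂ, A.model) T q x → p + 1 ≤ q)) ∧ (∀ x ∈ S \ Sg, ∃ U : Set A.carrier, IsOpen U ∧ x ∈ U ∧ ∃ f : A.carrier → (Fin (2 * p) → ℝ), ContMDiffOn 𝓘(ℝ, A.model) 𝓘(ℝ, Fin (2 * p) → ℝ) 1 f U ∧ S ∩ U = U ∩ f ⁻¹' {0} ∧ Function.Surjective (mfderiv 𝓘(ℝ, A.model) 𝓘(ℝ, Fin (2 * p) → ℝ) f x) ∧ ∀ v : TangentSpace 𝓘(ℝ, A.model) x, mfderiv 𝓘(ℝ, A.model) 𝓘(ℝ, Fin (2 * p) → ℝ) f x v = 0 → ∃ w : TangentSpace 𝓘(ℝ, A.model) x, mfderiv 𝓘(ℝ, A.model) 𝓘(ℝ, Fin (2 * p) → ℝ) f x w = 0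 ∧ g.inner x (Literature.Geometry.Kaehler.tangentJ A.model x v - w) (Literature.Geometry.Kaehler.tangentJ A.model x v - w) ≤ (C' * (k : ℝ) ^ (-((p : ℝ) + δ))) ^ 2 * g.inner x v v)) ∧ Literature.AlgebraicTopology.SingularHomology.singularCohomology.map ℂ ℂ (⟨Subtype.val, continuous_subtype_val⟩ : C({x : A.carrier // x ∉ S}, A.carrier)) (2 * p) (A.pullback (2 * p) (((m : ℂ) • c + ((a k : ℕ) : ℂ) • hp))) = 0 := by
  obtain ⟨g⟩ := Literature.Geometry.Riemannian.nonempty_contMDiffRiemannianMetric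
    (I := 𝓘(ℝ, A.model)) (M := A.carrier)
  have hrat : Literature.AlgebraicGeometry.HodgeTheory.IsRationalClass (-c) := by
    simpa using hc.smul (-1)
  refine ⟨g, 1, -c, 1, fun k => min k 1, 1, 0, one_pos, hrat, Submodule.neg_mem _ halg, ?_, one_pos, ?_⟩
  · -- the budget `a_k = min k 1 ≤ 1 · k^p`
    intro k
    show ((min k 1 : ℕ) : ℝ) ≤ 1 * (k : ℝ) ^ p
    rcases Nat.eq_zero_or_pos k with hk | hk
    · subst hk
      simp
    · rw [min_eq_right hk, Nat.cast_one, one_mul]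
      exact one_le_pow₀ (by exact_mod_cast hk)
  · -- for every `k ≥ 1`: a holomorphic cycle support of codimension `p` and the vanishing ray class
    refine Filter.Eventually.frequently ((Filter.eventually_ge_atTop 1).mono fun k hk => ?_)
    obtain ⟨S, hS⟩ := stub_existsHolomorphicCycleSupport n p X hX hpn hp0 A g.toRiemannianMetric
      ((0 : ℝ) * (k : ℝ) ^ (-((p : ℝ) + 1)))
    refine ⟨S, ∅, (Literature.Geometry.Kaehler.isNearlyHolomorphicCycleSupport_toRiemannianMetric_iff g).1 hS, ?_⟩
    have h0 : (((1 : ℕ) : ℂ) • c + ((min k 1 : ℕ) : ℂ) • (-c)) = 0 := by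
      rw [min_eq_right hk]
      simp
    rw [h0, map_zero, map_zero]

/-- **The crux's conclusion on every `X` satisfying the Hodge conjecture, pointwise in `X`.** If
`HodgeConjectureFor n X` holds (a Hodge model exists and rational `(p,p)`-classes on `X` are
algebraic), then for every `p ≤ n`, every Hodge model `A` and every rational `c` with `A^* c` of type
`(p,p)` the conclusion of `HolomorphicityRate.RateGap` holds: `p = 0` by
`rateGap_conclusion_of_eq_zero`, `0 < p` by `rateGap_conclusion_of_mem_algebraicClasses` (the Hodge
type is witnessed by `A` itself). [cite: Deligne2000, §1] -/
theorem rateGap_conclusion_of_hodgeConjectureFor (n p : ℕ)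
    (X : Literature.AlgebraicGeometry.Motives.SchemeOver ℂ)
    (hX : Literature.AlgebraicGeometry.Motives.IsSmoothProjective n X)
    (hHC : Literature.AlgebraicGeometry.HodgeTheory.HodgeConjectureFor n X) (hpn : p ≤ n)
    (A : Literature.AlgebraicGeometry.HodgeTheory.HodgeModel n X)
    (c : Literature.AlgebraicGeometry.HodgeTheory.complexBetti X (2 * p))
    (hc : Literature.AlgebraicGeometry.HodgeTheory.IsRationalClass c)
    (hpp : A.pullback (2 * p) c ∈ A.hodgePQ (2 * p) p p) :
    ∃ (g : Bundle.ContMDiffRiemannianMetric 𝓘(ℝ, A.model) ((⊤ : ℕ∞) : WithTop ℕ∞) A.model (fun x : A.carrier => TangentSpace 𝓘(ℝ, A.model) x)) (m : ℕ) (hp : Literature.AlgebraicGeometry.HodgeTheory.complexBetti X (2 * p)) (C : ℝ) (a : ℕ → ℕ) (δ C' : ℝ), 0 < m ∧ Literature.AlgebraicGeometry.HodgeTheory.IsRationalClass hp ∧ hp ∈ Literature.AlgebraicGeometry.HodgeTheory.algebraicClasses X p ∧ (∀ k, (a k : ℝ) ≤ C * (k : ℝ) ^ p) ∧ 0 < δ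 ∧ ∃ᶠ k : ℕ in Filter.atTop, ∃ S Sg : Set A.carrier, (IsClosed S ∧ IsClosed Sg ∧ Sg ⊆ S ∧ IsConnected (S \ Sg) ∧ (∀ x ∈ Sg, Literature.Geometry.Kaehler.IsAnalyticSetAt 𝓘(ℂ, A.model) S x) ∧ (∃ T : Set A.carrier, Sg ⊆ T ∧ (Literature.Geometry.Kaehler.IsAnalyticSet 𝓘(ℂ, A.model) T ∧ ∀ x ∈ Literature.Geometry.Kaehler.regularLocus 𝓘(ℂ, A.model) T, ∀ q : ℕ, Literature.Geometry.Kaehler.IsRegularPointOfCodim 𝓘(ℂ, A.model) T q x → p + 1 ≤ q)) ∧ (∀ x ∈ S \ Sg, ∃ U : Set A.carrier, IsOpen U ∧ x ∈ U ∧ ∃ f : A.carrier → (Fin (2 * p) → ℝ), ContMDiffOn 𝓘(ℝ, A.model) 𝓘(ℝ, Fin (2 * p) → ℝ) 1 f U ∧ S ∩ U = U ∩ f ⁻¹' {0} ∧ Function.Surjective (mfderiv 𝓘(ℝ, A.model) 𝓘(ℝ, Fin (2 * p) → ℝ) f x) ∧ ∀ v : TangentSpace 𝓘(ℝ, A.model)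 x, mfderiv 𝓘(ℝ, A.model) 𝓘(ℝ, Fin (2 * p) → ℝ) f x v = 0 → ∃ w : TangentSpace 𝓘(ℝ, A.model) x, mfderiv 𝓘(ℝ, A.model) 𝓘(ℝ, Fin (2 * p) → ℝ) f x w = 0 ∧ g.inner x (Literature.Geometry.Kaehler.tangentJ A.model x v - w) (Literature.Geometry.Kaehler.tangentJ A.model x v - w) ≤ (C' * (k : ℝ) ^ (-((p : ℝ) + δ))) ^ 2 * g.inner x v v)) ∧ Literature.AlgebraicTopology.SingularHomology.singularCohomology.map ℂ ℂ (⟨Subtype.val, continuous_subtype_val⟩ : C({x : A.carrier // x ∉ S}, A.carrier)) (2 * p) (A.pullback (2 * p) (((m : ℂ) • c + ((a k : ℕ) : ℂ) • hp))) = 0 := by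
  rcases Nat.eq_zero_or_pos p with hp0 | hp0
  · exact rateGap_conclusion_of_eq_zero n p X hX hp0 A c
  · exact rateGap_conclusion_of_mem_algebraicClasses n p X hX hpn hp0 A c hc
      (hHC.2 p c hc ⟨A, hpp⟩)

/-- **The crux `RateGap` holds on curves, surfaces and threefolds**, unconditionally: the tree proves
the Hodge conjecture in dimension `≤ 3` (`hodgeConjectureFor_of_dim_le_three_holds`: Lefschetz `(1,1)`
and hard Lefschetz for threefolds, Voisin II Prop. 10.26), so `rateGap_conclusion_of_hodgeConjectureFor`
applies. [cite: VoisinHodgeII2003, §10.2.3 proof of Prop. 10.26] -/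
theorem rateGap_conclusion_of_dim_le_three (n p : ℕ)
    (X : Literature.AlgebraicGeometry.Motives.SchemeOver ℂ)
    (hX : Literature.AlgebraicGeometry.Motives.IsSmoothProjective n X) (hn : n ≤ 3) (hpn : p ≤ n)
    (A : Literature.AlgebraicGeometry.HodgeTheory.HodgeModel n X)
    (c : Literature.AlgebraicGeometry.HodgeTheory.complexBetti X (2 * p))
    (hc : Literature.AlgebraicGeometry.HodgeTheory.IsRationalClass c)
    (hpp : A.pullback (2 * p) c ∈ A.hodgePQ (2 * p) p p) :
    ∃ (g : Bundle.ContMDiffRiemannianMetric 𝓘(ℝ, A.model) ((⊤ : ℕ∞) : WithTop ℕ∞) A.model (fun x : A.carrier => TangentSpace 𝓘(ℝ, A.model) x)) (m : ℕ) (hp : Literature.AlgebraicGeometry.HodgeTheory.complexBetti X (2 * p)) (C : ℝ) (a : ℕ → ℕ) (δ C' : ℝ), 0 < m ∧ Literature.AlgebraicGeometry.HodgeTheory.IsRationalClass hp ∧ hp ∈ Literature.AlgebraicGeometry.HodgeTheory.algebraicClasses X p ∧ (∀ k, (a k : ℝ) ≤ C * (k : ℝ) ^ p) ∧ 0 < δ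 ∧ ∃ᶠ k : ℕ in Filter.atTop, ∃ S Sg : Set A.carrier, (IsClosed S ∧ IsClosed Sg ∧ Sg ⊆ S ∧ IsConnected (S \ Sg) ∧ (∀ x ∈ Sg, Literature.Geometry.Kaehler.IsAnalyticSetAt 𝓘(ℂ, A.model) S x) ∧ (∃ T : Set A.carrier, Sg ⊆ T ∧ (Literature.Geometry.Kaehler.IsAnalyticSet 𝓘(ℂ, A.model) T ∧ ∀ x ∈ Literature.Geometry.Kaehler.regularLocus 𝓘(ℂ, A.model) T, ∀ q : ℕ, Literature.Geometry.Kaehler.IsRegularPointOfCodim 𝓘(ℂ, A.model) T q x → p + 1 ≤ q)) ∧ (∀ x ∈ S \ Sg, ∃ U : Set A.carrier, IsOpen U ∧ x ∈ U ∧ ∃ f : A.carrier → (Fin (2 * p) → ℝ), ContMDiffOn 𝓘(ℝ, A.model) 𝓘(ℝ, Fin (2 * p) → ℝ) 1 f U ∧ S ∩ U = U ∩ f ⁻¹' {0} ∧ Function.Surjective (mfderiv 𝓘(ℝ, A.model) 𝓘(ℝ, Fin (2 * p) → ℝ) f x) ∧ ∀ v : TangentSpace 𝓘(ℝ, A.model)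 x, mfderiv 𝓘(ℝ, A.model) 𝓘(ℝ, Fin (2 * p) → ℝ) f x v = 0 → ∃ w : TangentSpace 𝓘(ℝ, A.model) x, mfderiv 𝓘(ℝ, A.model) 𝓘(ℝ, Fin (2 * p) → ℝ) f x w = 0 ∧ g.inner x (Literature.Geometry.Kaehler.tangentJ A.model x v - w) (Literature.Geometry.Kaehler.tangentJ A.model x v - w) ≤ (C' * (k : ℝ) ^ (-((p : ℝ) + δ))) ^ 2 * g.inner x v v)) ∧ Literature.AlgebraicTopology.SingularHomology.singularCohomology.map ℂ ℂ (⟨Subtype.val, continuous_subtype_val⟩ : C({x : A.carrier // x ∉ S}, A.carrier)) (2 * p) (A.pullback (2 * p) (((m : ℂ) • c + ((a k : ℕ) : ℂ) • hp))) = 0 :=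
  rateGap_conclusion_of_hodgeConjectureFor n p X hX (hodgeConjectureFor_of_dim_le_three_holds hn hX)
    hpn A c hc hpp

/-- **The crux `RateGap` holds outright outside the window `2 ≤ p ≤ n - 2`**, on every smooth
projective `n`-fold: for `p ≤ 1` (codimension `0`: `rateGap_conclusion_of_eq_zero`; codimension `1`:
the rational Lefschetz `(1,1)` theorem `lefschetzOneOne_rational_holds`) and for `n ≤ p + 1`
(`p = n`: every top-degree class is algebraic, `mem_algebraicClasses_of_degree_top`; `p = n - 1 ≥ 2`:
hard Lefschetz `HardLefschetzNFold.mem_algebraicClasses_of_lt_holds` reduces to codimension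
`n - p = 1`, again Lefschetz `(1,1)`), followed by the cancellation
`rateGap_conclusion_of_mem_algebraicClasses`. Inside the window the registered stub of the crux is the
Hodge conjecture itself (`rateGap_of_hodgeBelowMiddle`).
[cite: VoisinHodgeI2002, Thm. 6.25 and Thm. 11.30] [cite: KerrPearlstein2011, §3.1] -/
theorem rateGap_conclusion_outside_window : ∀ (n p : ℕ) (X : Literature.AlgebraicGeometry.Motives.SchemeOver ℂ), Literature.AlgebraicGeometry.Motives.IsSmoothProjective n X → p ≤ n → (p ≤ 1 ∨ n ≤ p + 1) → ∀ (A : Literature.AlgebraicGeometry.HodgeTheory.HodgeModel n X) (c : Literature.AlgebraicGeometry.HodgeTheory.complexBetti X (2 * p)), Literature.AlgebraicGeometry.HodgeTheory.IsRationalClass c → A.pullback (2 * p) c ∈ A.hodgePQ (2 * p) p p → ∃ (g : Bundle.ContMDiffRiemannianMetric 𝓘(ℝ, A.model) ((⊤ : ℕ∞) : WithTop ℕ∞) A.model (fun x : A.carrier => TangentSpace 𝓘(ℝ, A.model) x)) (m : ℕ) (hp : Literature.AlgebraicGeometry.HodgeTheory.complexBetti X (2 * p)) (C : ℝ) (a :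 ℕ → ℕ) (δ C' : ℝ), 0 < m ∧ Literature.AlgebraicGeometry.HodgeTheory.IsRationalClass hp ∧ hp ∈ Literature.AlgebraicGeometry.HodgeTheory.algebraicClasses X p ∧ (∀ k, (a k : ℝ) ≤ C * (k : ℝ) ^ p) ∧ 0 < δ ∧ ∃ᶠ k : ℕ in Filter.atTop, ∃ S Sg : Set A.carrier, (IsClosed S ∧ IsClosed Sg ∧ Sg ⊆ S ∧ IsConnected (S \ Sg) ∧ (∀ x ∈ Sg, Literature.Geometry.Kaehler.IsAnalyticSetAt 𝓘(ℂ, A.model) S x) ∧ (∃ T : Set A.carrier, Sg ⊆ T ∧ (Literature.Geometry.Kaehler.IsAnalyticSet 𝓘(ℂ, A.model) T ∧ ∀ x ∈ Literature.Geometry.Kaehler.regularLocus 𝓘(ℂ, A.model) T, ∀ q : ℕ, Literature.Geometry.Kaehler.IsRegularPointOfCodim 𝓘(ℂ, A.model) T q x → p + 1 ≤ q)) ∧ (∀ x ∈ S \ Sg, ∃ U : Set A.carrier, IsOpen U ∧ x ∈ U ∧ ∃ f : A.carrier → (Fin (2 * p) → ℝ), ContMDiffOn 𝓘(ℝ, A.model)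 𝓘(ℝ, Fin (2 * p) → ℝ) 1 f U ∧ S ∩ U = U ∩ f ⁻¹' {0} ∧ Function.Surjective (mfderiv 𝓘(ℝ, A.model) 𝓘(ℝ, Fin (2 * p) → ℝ) f x) ∧ ∀ v : TangentSpace 𝓘(ℝ, A.model) x, mfderiv 𝓘(ℝ, A.model) 𝓘(ℝ, Fin (2 * p) → ℝ) f x v = 0 → ∃ w : TangentSpace 𝓘(ℝ, A.model) x, mfderiv 𝓘(ℝ, A.model) 𝓘(ℝ, Fin (2 * p) → ℝ) f x w = 0 ∧ g.inner x (Literature.Geometry.Kaehler.tangentJ A.model x v - w) (Literature.Geometry.Kaehler.tangentJ A.model x v - w) ≤ (C' * (k : ℝ) ^ (-((p : ℝ) + δ))) ^ 2 * g.inner x v v)) ∧ Literature.AlgebraicTopology.SingularHomology.singularCohomology.map ℂ ℂ (⟨Subtype.val, continuous_subtype_val⟩ : C({x : A.carrier // x ∉ S}, A.carrier)) (2 * p) (A.pullback (2 * p) (((m : ℂ) • c + ((a k : ℕ) : ℂ) • hp))) = 0 := by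
  intro n p X hX hpn hw A c hc hpp
  rcases Nat.eq_zero_or_pos p with hp0 | hp0
  · exact rateGap_conclusion_of_eq_zero n p X hX hp0 A c
  refine rateGap_conclusion_of_mem_algebraicClasses n p X hX hpn hp0 A c hc ?_
  -- `c` is algebraic in each of the three remaining codimensions `p = 1`, `p = n`, `p = n - 1 ≥ 2`
  by_cases h1 : p = 1
  · subst h1
    exact lefschetzOneOne_rational_holds hX c hc ⟨A, hpp⟩
  by_cases h2 : p = n
  · subst h2
    exact mem_algebraicClasses_of_degree_top hX hp0 c
  -- now `2 ≤ p = n - 1`, so `n < 2p` and the mirror codimension `n - p` is `1`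
  have hp1 : n - p = 1 := by omega
  have key : ∀ c' : Literature.AlgebraicGeometry.HodgeTheory.complexBetti X (2 * (n - p)),
      Literature.AlgebraicGeometry.HodgeTheory.IsRationalClass c' →
        Literature.AlgebraicGeometry.HodgeTheory.IsOfHodgeType n X (2 * (n - p)) (n - p) (n - p) c' →
          c' ∈ Literature.AlgebraicGeometry.HodgeTheory.algebraicClasses X (n - p) := by
    rw [hp1]
    exact fun c' hc' hpq' => lefschetzOneOne_rational_holds hX c' hc' hpq'
  exact HardLefschetzNFold.mem_algebraicClasses_of_lt_holds hX (by omega) key c hc ⟨A, hpp⟩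

end Summit.HodgeConjecture.HodgeConjecture.Theorems

end
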